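import Summits.QuantumFields.YangMills.Theorems.AllWindowsColdBoxBoxHighLineSmallFieldInsideFPByName
import Summits.QuantumFields.YangMills.Theorems.AllWindowsColdBoxBoxHighLineWilsonPlaquetteTaylor
import Summits.QuantumFields.YangMills.Theorems.AllWindowsColdBoxBoxHighLineErrorBudget

/-!
# The tilt exponent on the CUBIC-CUT small field: `sup_{D′} |tiltU| ≤ λ + o(1)` with NO `β·H⁴·s³` term (U5-BLOCKERS §2 L4, planner ym-idea-2 g18
# «then sup_{D′}|U| ≤ 2 holds with κ₃ free of the V₃ constraint»; LINE-20 U5 ⟨stmt-QuantumFields-24336⟩; U5 prep, helper-grade; U5 OPEN)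

Width seat `ym-line-sfw-p2-w4` (prover-ym-line-sfw-p2-w4-g29-0), continuing w4 g28's ✓`TiltSup.*` (ASSEMBLY-S5 §5 sup bounds).  ✓`TiltSup.abs_tiltU_le`
bounds `|tiltU| ≤ C(1+log H)^m(|β|H⁴s³ + H⁶s²)`; the `|β|H⁴s³` is the CUBIC vertex (and the crude cubic-order bound of the quartic Wilson part), and it is
what forces `κ₃ < (1/2 − 4θ)/3` (constraint (a), blocker B4).  On the complement of the cubic cut `E = {λ + C₅βH⁴s⁵ ≤ |cubicVertex β H ·|}` (whose
FP-weight is rare by w4's ✓`SmallFieldFP.cubicCutInsideFP`) the cubic vertex is `< λ + C₅βH⁴s⁵` by definition, and the REST of the tilt is genuinely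
quartic or ghost/Haar:
* `abs_quarticWilson_le_quartic` — `|quarticWilson β H a| ≤ C_W·|β|·H⁴·s⁴` (✓7a `wilsonPlaquetteTaylor` by name, via ✓`abs_chartPlaqCost_even_rem_le_of`;
  compare the crude ✓`abs_quarticWilson_le` with `s³`);
* ★ `abs_tiltU_add_cubicVertex_le` — the EVEN part: `|tiltU β H a + cubicVertex β H a| ≤ C(1+log H)^m(|β|H⁴s⁴ + H⁶s²)` on `smallField H s`, `s ≤ 1`, `sH² ≤ c₀`;
* ★ `abs_tiltU_le_on_cubicCut` — for every `C₅ ≥ 0`, `λ`: on `smallField H s ∖ E`, `|tiltU β H a| ≤ λ + (C + C₅)(1+log H)^m(|β|H⁴s⁴ + H⁶s²)`;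
* ★★ `exists_forall_abs_tiltU_le_on_cubicCut` — β-letters: for `0 < θ`, `4θ + 4κ₃ < 1`, `6θ + 2κ₃ < 1` (⇒ `2θ + κ₃ < 1/2`), every `C₅ ≥ 0`, `λ`, `ε > 0`
  there is `β₀` with `|tiltU β H a| ≤ λ + ε` for `β ≥ β₀`, `1 ≤ H ≤ β^θ + 1`, `a ∈ smallField H (β^{−1/2+κ₃})`, `|cubicVertex β H a| < λ + C₅βH⁴s⁵`
  (so with `λ = 1`, `ε = 1`: `sup_{D′}|U| ≤ 2` — the (K2)-type constraints replace (a)).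

Everything proved; no definitions; standard axioms.  HONEST LABEL: U5 prep, helper-grade (lift L4 of the NEXT rung U5 of a critic-PASSed DRAFT line); U5 ⟨24336⟩,
⟨24004⟩ and the seat's own crux ⟨22884⟩ remain OPEN; no stub is closed by name, no crux, rung or summit is proved; **the Yang–Mills mass gap is NOT proved by
this file; no summit is proved by a line.**
-/

set_option autoImplicit false

open MeasureTheory Real Finset
open Literature.Probability.LatticeModels (Site)
open Literature.MathematicalPhysics.QuantumLattice (ZdPlaquette plaquettesTouching)
open Literature.MathematicalPhysics.QuantumFieldTheory.AxialGauge (boxEdges)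

namespace Summit.QuantumFields.YangMills.Theorems.AllWindowsColdBoxBoxHighLine

namespace TiltSup

variable {H : ℕ}

/-! ## The quartic Wilson part is quartic -/

/-- **`|quarticWilson β H a| ≤ C_W·|β|·H⁴·s⁴`** on `smallField H s`, `0 ≤ s ≤ 1`, `H ≥ 1` (✓7a `wilsonPlaquetteTaylor` per plaquette, `≤ 4096H⁴` plaquettes). -/
theorem abs_quarticWilson_le_quartic : ∃ C : ℝ, 0 ≤ C ∧ ∀ H : ℕ, 1 ≤ H → ∀ β s : ℝ, 0 ≤ s → s ≤ 1 →
    ∀ a ∈ smallField H s, |quarticWilson β H a| ≤ C * |β| * (H : ℝ) ^ 4 * s ^ 4 := by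
  obtain ⟨C, hC⟩ := abs_chartPlaqCost_even_rem_le_of wilsonPlaquetteTaylor
  refine ⟨4096 * max C 0, by positivity, fun H hH β s hs0 hs1 a ha => ?_⟩
  have hC0 : C ≤ max C 0 := le_max_left _ _
  rw [quarticWilson, abs_mul]
  have hsum : |∑ p ∈ plaquettesTouching (boxEdges 4 (2 * H + 1)),
      (chartPlaqCost H p.1 p.2.1.1 p.2.1.2 a - linCurvSq H (p.1, p.2.1.1, p.2.1.2) a - chartPlaqCostOdd H p.1 p.2.1.1 p.2.1.2 a)| ≤
      (plaquettesTouching (boxEdges 4 (2 * H + 1))).card * (max C 0 * s ^ 4) := by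
    refine (Finset.abs_sum_le_sum_abs _ _).trans ?_
    calc ∑ p ∈ plaquettesTouching (boxEdges 4 (2 * H + 1)),
          |chartPlaqCost H p.1 p.2.1.1 p.2.1.2 a - linCurvSq H (p.1, p.2.1.1, p.2.1.2) a - chartPlaqCostOdd H p.1 p.2.1.1 p.2.1.2 a|
        ≤ ∑ _p ∈ plaquettesTouching (boxEdges 4 (2 * H + 1)), max C 0 * s ^ 4 :=
          Finset.sum_le_sum fun p _ =>
            (hC H s hs0 hs1 a ha p.1 p.2.1.1 p.2.1.2 (ne_of_lt p.2.2)).trans (mul_le_mul_of_nonneg_right hC0 (by positivity))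
      _ = _ := by rw [Finset.sum_const, nsmul_eq_mul]
  have hcard := card_plaquettesTouching_le' hH
  have hs4 : 0 ≤ max C 0 * s ^ 4 := by positivity
  calc |β| * |∑ p ∈ plaquettesTouching (boxEdges 4 (2 * H + 1)),
        (chartPlaqCost H p.1 p.2.1.1 p.2.1.2 a - linCurvSq H (p.1, p.2.1.1, p.2.1.2) a - chartPlaqCostOdd H p.1 p.2.1.1 p.2.1.2 a)|
      ≤ |β| * ((plaquettesTouching (boxEdges 4 (2 * H + 1))).card * (max C 0 * s ^ 4)) :=
        mul_le_mul_of_nonneg_left hsum (abs_nonneg _)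
    _ ≤ |β| * (4096 * (H : ℝ) ^ 4 * (max C 0 * s ^ 4)) := by gcongr
    _ = 4096 * max C 0 * |β| * (H : ℝ) ^ 4 * s ^ 4 := by ring

/-! ## The even part of the tilt exponent -/

/-- ★ **The EVEN part of the tilt exponent**: `|tiltU β H a + cubicVertex β H a| ≤ C·(1+log H)^m·(|β|·H⁴·s⁴ + H⁶·s²)` on `smallField H s`,
`0 ≤ s ≤ 1`, `s·H² ≤ c₀` (`tiltU + V₃ = −W₄ − β(Φ − Σ|d*a|²) + ghost + Haar`; ✓`abs_quarticWilson_le_quartic`, ✓`abs_landauPhi_sub_divLinSq_le`,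
✓`abs_ghostLogRatio_le_of ghostTaylor`, ✓`abs_haarLogRatio_le`). -/
theorem abs_tiltU_add_cubicVertex_le :
    ∃ C c₀ : ℝ, ∃ m : ℕ, 0 ≤ C ∧ 0 < c₀ ∧ ∀ H : ℕ, 1 ≤ H → ∀ β s : ℝ, 0 ≤ s → s ≤ 1 → s * (H : ℝ) ^ 2 ≤ c₀ →
      ∀ a ∈ smallField H s, |tiltU β H a + cubicVertex β H a| ≤ C * (1 + Real.log H) ^ m * (|β| * (H : ℝ) ^ 4 * s ^ 4 + (H : ℝ) ^ 6 * s ^ 2) := by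
  obtain ⟨CW, hCW, hW⟩ := abs_quarticWilson_le_quartic
  obtain ⟨Cg, c₀, m, hCg, hc₀, hg⟩ := abs_ghostLogRatio_le_of ghostTaylor
  obtain ⟨CΦ, hCΦ, hΦ⟩ := abs_landauPhi_sub_divLinSq_le
  obtain ⟨Ch, hCh, hh⟩ := abs_haarLogRatio_le
  refine ⟨CW + CΦ + 2 * Cg + 216 * (1 / 3 + Ch), c₀, m, by positivity, hc₀, fun H hH β s hs0 hs1 hsH a ha => ?_⟩
  -- atoms
  set A := |β| * (H : ℝ) ^ 4 * s ^ 4 with hA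
  set B := (H : ℝ) ^ 6 * s ^ 2 with hB
  set L := (1 + Real.log (H : ℝ)) ^ m with hLdef
  have hH1 : (1 : ℝ) ≤ H := by exact_mod_cast hH
  have hL1 : 1 ≤ L := one_le_pow₀ (by have := Real.log_nonneg hH1; linarith)
  have hA0 : 0 ≤ A := by positivity
  have hB0 : 0 ≤ B := by positivity
  have hs43 : s ^ 4 ≤ s ^ 3 := pow_le_pow_of_le_one hs0 hs1 (by norm_num)
  have hs32 : s ^ 3 ≤ s ^ 2 := pow_le_pow_of_le_one hs0 hs1 (by norm_num)
  have hH46 : (H : ℝ) ^ 4 ≤ (H : ℝ) ^ 6 := pow_le_pow_right₀ hH1 (by norm_num)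
  -- the four pieces
  have h1 : |quarticWilson β H a| ≤ CW * A := by
    rw [hA, ← mul_assoc, ← mul_assoc]; exact hW H hH β s hs0 hs1 a ha
  have h2 : |β * (landauPhi H (edgeChart H a) - divLinSq H a)| ≤ CΦ * A := by
    rw [abs_mul]
    calc |β| * |landauPhi H (edgeChart H a) - divLinSq H a| ≤ |β| * (CΦ * (H : ℝ) ^ 4 * s ^ 4) :=
          mul_le_mul_of_nonneg_left (hΦ H hH s a ha) (abs_nonneg _)
      _ = CΦ * A := by rw [hA]; ring
  have h3 : |ghostLogRatio H a| ≤ 2 * Cg * L * B := by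
    calc |ghostLogRatio H a| ≤ Cg * L * (H : ℝ) ^ 6 * (s ^ 2 + s ^ 3) := by rw [hLdef]; exact hg H hH s hs0 hsH a ha
      _ ≤ Cg * L * (H : ℝ) ^ 6 * (s ^ 2 + s ^ 2) := by gcongr
      _ = 2 * Cg * L * B := by rw [hB]; ring
  have h4 : |haarLogRatio H a| ≤ 216 * (1 / 3 + Ch) * B := by
    have hcard := SmallFieldFP.card_landauFree_le (H := H) hH
    calc |haarLogRatio H a| ≤ Fintype.card (LandauFree H) * (s ^ 2 / 3 + Ch * s ^ 4) := hh H s hs0 hs1 a ha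
      _ ≤ 216 * (H : ℝ) ^ 4 * (s ^ 2 / 3 + Ch * s ^ 4) := mul_le_mul_of_nonneg_right hcard (by positivity)
      _ ≤ 216 * (H : ℝ) ^ 6 * (s ^ 2 / 3 + Ch * s ^ 2) := by
          have hXY : s ^ 2 / 3 + Ch * s ^ 4 ≤ s ^ 2 / 3 + Ch * s ^ 2 := by
            have := mul_le_mul_of_nonneg_left (hs43.trans hs32) hCh
            linarith
          exact mul_le_mul (mul_le_mul_of_nonneg_left hH46 (by norm_num)) hXY (by positivity) (by positivity)
      _ = 216 * (1 / 3 + Ch) * B := by rw [hB]; ring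
  -- triangle inequality on `tiltU + V₃ = −W₄ − β(Φ − divLinSq) + ghost + Haar`
  have e : tiltU β H a + cubicVertex β H a = -quarticWilson β H a + -(β * (landauPhi H (edgeChart H a) - divLinSq H a)) +
      ghostLogRatio H a + haarLogRatio H a := by rw [tiltU]; ring
  have htri : |tiltU β H a + cubicVertex β H a| ≤ |quarticWilson β H a| + |β * (landauPhi H (edgeChart H a) - divLinSq H a)| +
      |ghostLogRatio H a| + |haarLogRatio H a| := by
    rw [e]
    calc |-quarticWilson β H a + -(β * (landauPhi H (edgeChart H a) - divLinSq H a)) + ghostLogRatio H a + haarLogRatio H a|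
        ≤ |-quarticWilson β H a + -(β * (landauPhi H (edgeChart H a) - divLinSq H a)) + ghostLogRatio H a| + |haarLogRatio H a| :=
          abs_add_le _ _
      _ ≤ |-quarticWilson β H a + -(β * (landauPhi H (edgeChart H a) - divLinSq H a))| + |ghostLogRatio H a| + |haarLogRatio H a| := by
          gcongr; exact abs_add_le _ _
      _ ≤ |-quarticWilson β H a| + |-(β * (landauPhi H (edgeChart H a) - divLinSq H a))| + |ghostLogRatio H a| + |haarLogRatio H a| := by
          gcongr; exact abs_add_le _ _
      _ = _ := by rw [abs_neg, abs_neg]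
  have hsum : |tiltU β H a + cubicVertex β H a| ≤ CW * A + CΦ * A + 2 * Cg * L * B + 216 * (1 / 3 + Ch) * B := by linarith
  refine hsum.trans ?_
  have hAL : A ≤ L * A := le_mul_of_one_le_left hA0 hL1
  have hBL : B ≤ L * B := le_mul_of_one_le_left hB0 hL1
  nlinarith [mul_nonneg hCW hA0, mul_nonneg hCΦ hA0, mul_nonneg hCg hB0, mul_nonneg hCh hB0,
    mul_nonneg (mul_nonneg hCW hA0) (sub_nonneg.2 hL1), mul_nonneg (mul_nonneg hCΦ hA0) (sub_nonneg.2 hL1),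
    mul_nonneg (mul_nonneg hCh hB0) (sub_nonneg.2 hL1)]

/-- ★ **The tilt exponent on the cubic-cut small field**: for every `C₅ ≥ 0` and `λ`, on `{a ∈ smallField H s | |cubicVertex β H a| < λ + C₅βH⁴s⁵}`:
`|tiltU β H a| ≤ λ + (C + C₅)·(1+log H)^m·(|β|H⁴s⁴ + H⁶s²)` (`0 ≤ s ≤ 1`, `s·H² ≤ c₀`). -/
theorem abs_tiltU_le_on_cubicCut :
    ∃ C c₀ : ℝ, ∃ m : ℕ, 0 ≤ C ∧ 0 < c₀ ∧ ∀ C₅ : ℝ, 0 ≤ C₅ → ∀ H : ℕ, 1 ≤ H → ∀ β s : ℝ, 0 ≤ s → s ≤ 1 → s * (H : ℝ) ^ 2 ≤ c₀ →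
      ∀ lam : ℝ, ∀ a ∈ smallField H s, |cubicVertex β H a| < lam + C₅ * β * (H : ℝ) ^ 4 * s ^ 5 →
        |tiltU β H a| ≤ lam + (C + C₅) * (1 + Real.log H) ^ m * (|β| * (H : ℝ) ^ 4 * s ^ 4 + (H : ℝ) ^ 6 * s ^ 2) := by
  obtain ⟨C, c₀, m, hC, hc₀, h⟩ := abs_tiltU_add_cubicVertex_le
  refine ⟨C, c₀, m, hC, hc₀, fun C₅ hC₅ H hH β s hs0 hs1 hsH lam a ha hcut => ?_⟩
  have hH1 : (1 : ℝ) ≤ H := by exact_mod_cast hH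
  have hL1 : 1 ≤ (1 + Real.log (H : ℝ)) ^ m := one_le_pow₀ (by have := Real.log_nonneg hH1; linarith)
  have heven := h H hH β s hs0 hs1 hsH a ha
  have hA0 : 0 ≤ |β| * (H : ℝ) ^ 4 * s ^ 4 := by positivity
  have hB0 : 0 ≤ (H : ℝ) ^ 6 * s ^ 2 := by positivity
  -- `C₅ β H⁴ s⁵ ≤ C₅ |β| H⁴ s⁴ ≤ C₅ (1+log H)^m (|β|H⁴s⁴ + H⁶s²)`
  have hshift : C₅ * β * (H : ℝ) ^ 4 * s ^ 5 ≤ C₅ * (1 + Real.log H) ^ m * (|β| * (H : ℝ) ^ 4 * s ^ 4 + (H : ℝ) ^ 6 * s ^ 2) := by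
    have h1 : C₅ * β * (H : ℝ) ^ 4 * s ^ 5 ≤ C₅ * (|β| * (H : ℝ) ^ 4 * s ^ 4) := by
      have hs54 : s ^ 5 ≤ s ^ 4 := pow_le_pow_of_le_one hs0 hs1 (by norm_num)
      have hb : β ≤ |β| := le_abs_self β
      calc C₅ * β * (H : ℝ) ^ 4 * s ^ 5 ≤ C₅ * |β| * (H : ℝ) ^ 4 * s ^ 5 := by gcongr
        _ ≤ C₅ * |β| * (H : ℝ) ^ 4 * s ^ 4 := by gcongr
        _ = C₅ * (|β| * (H : ℝ) ^ 4 * s ^ 4) := by ring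
    have h2 : |β| * (H : ℝ) ^ 4 * s ^ 4 ≤ (1 + Real.log H) ^ m * (|β| * (H : ℝ) ^ 4 * s ^ 4 + (H : ℝ) ^ 6 * s ^ 2) := by
      nlinarith
    calc C₅ * β * (H : ℝ) ^ 4 * s ^ 5 ≤ C₅ * (|β| * (H : ℝ) ^ 4 * s ^ 4) := h1
      _ ≤ C₅ * ((1 + Real.log H) ^ m * (|β| * (H : ℝ) ^ 4 * s ^ 4 + (H : ℝ) ^ 6 * s ^ 2)) := mul_le_mul_of_nonneg_left h2 hC₅
      _ = C₅ * (1 + Real.log H) ^ m * (|β| * (H : ℝ) ^ 4 * s ^ 4 + (H : ℝ) ^ 6 * s ^ 2) := by ring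
  have htri : |tiltU β H a| ≤ |tiltU β H a + cubicVertex β H a| + |cubicVertex β H a| := by
    have := abs_sub (tiltU β H a + cubicVertex β H a) (cubicVertex β H a)
    rwa [add_sub_cancel_right] at this
  have : (C + C₅) * (1 + Real.log H) ^ m * (|β| * (H : ℝ) ^ 4 * s ^ 4 + (H : ℝ) ^ 6 * s ^ 2) =
      C * (1 + Real.log H) ^ m * (|β| * (H : ℝ) ^ 4 * s ^ 4 + (H : ℝ) ^ 6 * s ^ 2) +
        C₅ * (1 + Real.log H) ^ m * (|β| * (H : ℝ) ^ 4 * s ^ 4 + (H : ℝ) ^ 6 * s ^ 2) := by ring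
  rw [this]
  linarith

/-! ## In the assembly's letters -/

/-- `|β|·(β^{−1/2+κ})⁴ = 1/β^{1−4κ}` (`β > 0`). -/
theorem abs_beta_mul_rpow_four {β κ : ℝ} (hβ : 0 < β) : |β| * (β ^ (-1 / 2 + κ)) ^ 4 = 1 / β ^ (1 - 4 * κ) := by
  rw [abs_of_pos hβ, ← Real.rpow_natCast, ← Real.rpow_mul hβ.le, one_div, ← Real.rpow_neg hβ.le]
  nth_rw 1 [← Real.rpow_one β]
  rw [← Real.rpow_add hβ]
  norm_num
  ring_nf

/-- ★★ **`sup_{D′} |tiltU| ≤ λ + ε` for `β ≥ β₀`** on the cubic-cut small field, in the assembly's parameters: for `0 < θ`, `4θ + 4κ₃ < 1`, `6θ + 2κ₃ < 1`,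
every `C₅ ≥ 0`, `λ`, `ε > 0` there is `β₀ ≥ 1` such that for all `β ≥ β₀`, all `H : ℕ` with `1 ≤ H ≤ β^θ + 1`, every `a ∈ smallField H (β^{−1/2+κ₃})` with
`|cubicVertex β H a| < λ + C₅·β·H⁴·s⁵` (`s = β^{−1/2+κ₃}`) satisfies `|tiltU β H a| ≤ λ + ε`.  (With `λ = ε = 1`: `sup_{D′}|U| ≤ 2`, no constraint (a).) -/
theorem exists_forall_abs_tiltU_le_on_cubicCut {θ κ₃ ε : ℝ} (hθ : 0 < θ) (h4 : 4 * θ + 4 * κ₃ < 1) (h6 : 6 * θ + 2 * κ₃ < 1)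
    {C₅ : ℝ} (hC₅ : 0 ≤ C₅) (lam : ℝ) (hε : 0 < ε) :
    ∃ β₀ : ℝ, 1 ≤ β₀ ∧ ∀ β : ℝ, β₀ ≤ β → ∀ H : ℕ, 1 ≤ H → (H : ℝ) ≤ β ^ θ + 1 →
      ∀ a ∈ smallField H (β ^ (-1 / 2 + κ₃)), |cubicVertex β H a| < lam + C₅ * β * (H : ℝ) ^ 4 * (β ^ (-1 / 2 + κ₃)) ^ 5 →
        |tiltU β H a| ≤ lam + ε := by
  obtain ⟨C, c₀, m, hC, hc₀, hU⟩ := abs_tiltU_le_on_cubicCut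
  have hθ0 : 0 ≤ θ := hθ.le
  have hε2 : 0 < ε / 2 := by linarith
  -- the three thresholds: `|β|H⁴s⁴ = H⁴/β^{1−4κ₃}`, `H⁶s² = H⁶/β^{1−2κ₃}`, premise `sH² = H²/β^{1/2−κ₃} ≤ c₀`
  obtain ⟨b₁, hb₁1, hb₁⟩ := ErrorBudget.exists_forall_natPow_log_le (k := 4) (γ := 1 - 4 * κ₃) hθ0 (by push_cast; linarith) hε2 (C + C₅) m 0
  obtain ⟨b₂, hb₂1, hb₂⟩ := ErrorBudget.exists_forall_natPow_log_le (k := 6) (γ := 1 - 2 * κ₃) hθ0 (by push_cast; linarith) hε2 (C + C₅) m 0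
  obtain ⟨b₃, hb₃1, hb₃⟩ := ErrorBudget.exists_forall_natPow_log_le (k := 2) (γ := 1 / 2 - κ₃) hθ0 (by push_cast; linarith) hc₀ 1 0 0
  refine ⟨max b₁ (max b₂ b₃), le_max_of_le_left hb₁1, fun β hβ H hH hHβ a ha hcut => ?_⟩
  have hβ1 : b₁ ≤ β := (le_max_left _ _).trans hβ
  have hβ2 : b₂ ≤ β := ((le_max_left _ _).trans (le_max_right _ _)).trans hβ
  have hβ3 : b₃ ≤ β := ((le_max_right _ _).trans (le_max_right _ _)).trans hβ
  have hβone : 1 ≤ β := hb₁1.trans hβ1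
  have hβpos : 0 < β := by linarith
  set s : ℝ := β ^ (-1 / 2 + κ₃) with hs
  have hs0 : 0 ≤ s := Real.rpow_nonneg hβpos.le _
  have hs1 : s ≤ 1 := rpow_neg_half_add_le_one hβone (by linarith)
  -- premise `s·H² ≤ c₀`
  have h3 := hb₃ β hβ3 H hH hHβ
  have hsH : s * (H : ℝ) ^ 2 ≤ c₀ := by
    have e : s * (H : ℝ) ^ 2 = 1 * (H : ℝ) ^ 2 * (1 + Real.log H) ^ 0 * (1 + Real.log β) ^ 0 / β ^ (1 / 2 - κ₃) := by
      rw [hs, rpow_eq_one_div hβpos, pow_zero, pow_zero]; ring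
    rw [e]; exact h3
  have hmain := hU C₅ hC₅ H hH β s hs0 hs1 hsH lam a ha hcut
  -- the two monomials
  have h1 := hb₁ β hβ1 H hH hHβ
  have h2 := hb₂ β hβ2 H hH hHβ
  have e1 : (C + C₅) * (1 + Real.log H) ^ m * (|β| * (H : ℝ) ^ 4 * s ^ 4) =
      (C + C₅) * (H : ℝ) ^ 4 * (1 + Real.log H) ^ m * (1 + Real.log β) ^ 0 / β ^ (1 - 4 * κ₃) := by
    rw [pow_zero, hs]
    have := abs_beta_mul_rpow_four (κ := κ₃) hβpos
    calc (C + C₅) * (1 + Real.log H) ^ m * (|β| * (H : ℝ) ^ 4 * (β ^ (-1 / 2 + κ₃)) ^ 4)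
        = (C + C₅) * (1 + Real.log H) ^ m * (H : ℝ) ^ 4 * (|β| * (β ^ (-1 / 2 + κ₃)) ^ 4) := by ring
      _ = (C + C₅) * (1 + Real.log H) ^ m * (H : ℝ) ^ 4 * (1 / β ^ (1 - 4 * κ₃)) := by rw [this]
      _ = _ := by ring
  have e2 : (C + C₅) * (1 + Real.log H) ^ m * ((H : ℝ) ^ 6 * s ^ 2) =
      (C + C₅) * (H : ℝ) ^ 6 * (1 + Real.log H) ^ m * (1 + Real.log β) ^ 0 / β ^ (1 - 2 * κ₃) := by
    rw [pow_zero, hs, rpow_sq_eq hβpos]; ring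
  have hsplit : (C + C₅) * (1 + Real.log H) ^ m * (|β| * (H : ℝ) ^ 4 * s ^ 4 + (H : ℝ) ^ 6 * s ^ 2) =
      (C + C₅) * (1 + Real.log H) ^ m * (|β| * (H : ℝ) ^ 4 * s ^ 4) + (C + C₅) * (1 + Real.log H) ^ m * ((H : ℝ) ^ 6 * s ^ 2) := by ring
  rw [hsplit, e1, e2] at hmain
  linarith

end TiltSup

end Summit.QuantumFields.YangMills.Theorems.AllWindowsColdBoxBoxHighLine
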